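import Summits.QuantumFields.YangMills.Theorems.UnitScaleTiltProp7JointRowOfLevelMasses
import Summits.QuantumFields.YangMills.Theorems.UnitScaleTiltProp7CornerCombH21DoubleSums
import HarnessLib

/-!
# Route `UnitScaleTilt`, crux K1 «MinimiserStabilityRegPr» (stmt-QuantumFields-19200), route-R E′ (A′) P-A2 (β), row `hMcomb₂` ⟸ H2-1(E) — brick M-3-R:
# THE PURE-REAL ASSEMBLY OF THE H2-1(E) `ℓ¹` KNIT — the level sums of px18 g4's LOCATE «H2-1(E) SUPPLIER — THE MEMBER KNIT SKELETON» (2686e4bb) §1(c)–(1h), in closed form,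
# every constant explicit and L-only: `E₀-term + Σ_{j<l}(STRAIGHT_j + LAMBDA_j) ≤ Am₂·(Lˡ)⁻¹ + Bm₂·Lˡ`

Cell `ym3-torus` (HUMAN RULING D-0037, YM ladder rung R3), D-0154 (3c) twin-width seat `ym-routeR-w3` (gen 8); px18 g4 10:40:50Z OPEN OFFER «M-3∕M-4», w3-20520 g12 yielded the
reals to this seat (10:42:15Z).  THEOREMS ONLY (0 `def`, 0 `sorry`), PURE REALS (Mathlib + ✓ `Prop7JointRowOfLevelMasses` + ✓ `Prop7CornerCombH21DoubleSums`);
`--supports stmt-QuantumFields-19200 --as helper`, count-neutral.  YM₃ on T³ is a ladder rung (R3) — NOT d = 4, NOT infinite volume, NOT a mass gap, NOT the Clay problem; nothing here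
claims H2-1, `hMcomb₂`, (β), E′, the stub, the crux or the gap.

THE SHAPES (memo §1; `n := l − 1 − j` the height of the re-based tower above the source level `j + 1`; `d = 3`; every per-step `ℓ¹` weight `w_m = L⁻²(1 + cα_m)` with
`Π_{m<i} w_m ≤ E·(L²)^{−i}`, `E` the window exponential — displayed).
* STRAIGHT (1c)+(1d): `S_j ≤ E·(L²)^{−n}·c_S·MASS_j`.
* LAMBDA (1e)+(1f): `Λ_j ≤ Σ_{i<n} E·(L²)^{−i}·c_Λ·(V·(L³)^{i+1}·((L³)^{n+1})⁻¹·MASS_j + V′·(L²)^{i+1}·GAP_j)` — the volume fraction of the reading boxes under the level-`l` corners and the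
  Hardy∕localised-mass price in the norm-gap currency.
* ROWS: `MASS_j ≤ Am·(Lʲ)⁻¹ + Bm·Lʲ` (`hMcomb`, every level), `GAP_j ≤ Bg·Lʲ` ((G_j), B-slot only), and the level-0 term `Z₀ ≤ E·(L²)^{−l}·c_S·M + Σ_{i<l} E·(L²)^{−i}·c_Λ·(V·(L³)^{i+1}·((L³)^{l+1})⁻¹·M + V′·(L²)^{i+1}·G₀)`
  (source `E_0 = e^{iX} − 1 − iX`, `‖E_0‖₁ ≤ M`, norm-gap `G₀ ≤ Bg` — the `j = −1` instance of the same chain).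
THE SUMS (this file): the inner Λ-sums are `Σ_{i<n}(L²)^{−i}(L³)^{i+1}((L³)^{n+1})⁻¹ = L^{−3n}Σ_{i<n}Lⁱ ≤ (L²)^{−n}∕(L−1)` (mass: the SAME damping as STRAIGHT) and `Σ_{i<n}(L²)^{−i}(L²)^{i+1} = n·L²`
(gap: a factor `n = l−1−j`); the outer sums are ✓ `levelSum_damped_le` (`Σ_{j<l}(L²)^{−(l−1−j)}(Am(Lʲ)⁻¹ + BmLʲ) ≤ Am·L²∕(L−1)·(Lˡ)⁻¹ + Bm·L²∕(L³−1)·Lˡ`) and ✓ `sum_range_sub_mul_pow_le`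
(`Σ_{j<l}(l−1−j)Lʲ ≤ Lˡ∕(L−1)²` — NO factor `l`).

WHAT IS PROVED (ns `…Theorems.Prop7CornerCombH21ERealAssembly`).
* §1 `inner_mass_sum_le`, `inner_gap_sum_eq`, `lambda_row_le` (the Λ-row of one source level in the two currencies), `level0_term_le`.
* §2 ★★ `h21E_real_assembly` — `Z₀ + Σ_{j<l}(S j + Λ j) ≤ Am₂·(Lˡ)⁻¹ + Bm₂·Lˡ` with
  `Am₂ = E·(c_S + c_ΛV∕(L−1))·(Am·L²∕(L−1) + M)`, `Bm₂ = E·(c_S + c_ΛV∕(L−1))·Bm·L²∕(L³−1) + E·c_Λ·V′·L²·(Bg∕(L−1)² + G₀)` (M-3 proper = instantiate the rows + `exact`).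
HONEST SCOPE.  Pure real bookkeeping; the rows are hypotheses here (their suppliers: M-1∕M-2 (px18∕px13 g7), `hMcomb` (the (II) lane), (G_j) (F-7b-2∕F-6d)); the shapes follow the memo and
may be re-cut to M-1∕M-2's SIGNED letters (constants only).

References: T. Bałaban, CMP 98 (1985) 17–51 [Balaban1985Averaging] ((43) p.24, (124)–(126) p.36); CMP 95 (1984) 17–40 [Balaban1984PropagatorsI] ((1.18)–(1.20) pp.19–20);
CMP 102 (1985) 277–309 [Balaban1985Variational] (Prop. 7 p.299).
-/

set_option autoImplicit false

noncomputable section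

open Finset
open scoped BigOperators
open Summit.QuantumFields.YangMills.Theorems.Prop7JointRowOfLevelMasses (levelSum_damped_le)
open Summit.QuantumFields.YangMills.Theorems.Prop7CornerCombH21DoubleSums (sum_range_pow_le sum_range_sub_mul_pow_le)

namespace Summit.QuantumFields.YangMills.Theorems.Prop7CornerCombH21ERealAssembly

/-! ## §1 The inner sums of the Λ-channel of one source level -/

/-- **THE MASS PART OF THE Λ-ROW DAMPS LIKE THE STRAIGHT ROW**: `Σ_{i<n} (L²)^{−i}·(L³)^{i+1}·((L³)^{n+1})⁻¹ ≤ ((L²)^n)⁻¹∕(L−1)` (`1 < L`): the volume fraction of the reading boxes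
(`(L³)^{i+1−(n+1)}`) beats the undamped comb sampling. [cite: Balaban1985Averaging, (125) p.36] -/
theorem inner_mass_sum_le {L : ℝ} (hL : 1 < L) (n : ℕ) :
    ∑ i ∈ range n, ((L ^ 2) ^ i)⁻¹ * ((L ^ 3) ^ (i + 1) * ((L ^ 3) ^ (n + 1))⁻¹) ≤ ((L ^ 2) ^ n)⁻¹ / (L - 1) := by
  have hL0 : 0 < L := by linarith
  have hLn3 : 0 < (L ^ 3) ^ (n + 1) := by positivity
  -- termwise: `(L²)^{−i}(L³)^{i+1}((L³)^{n+1})⁻¹ = Lⁱ·L³·((L³)^{n+1})⁻¹`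
  have hterm : ∀ i ∈ range n, ((L ^ 2) ^ i)⁻¹ * ((L ^ 3) ^ (i + 1) * ((L ^ 3) ^ (n + 1))⁻¹) = L ^ i * (L ^ 3 * ((L ^ 3) ^ (n + 1))⁻¹) := by
    intro i _
    have hL2i : (L ^ 2) ^ i ≠ 0 := by positivity
    have e : (L ^ 3) ^ (i + 1) = (L ^ 2) ^ i * (L ^ i * L ^ 3) := by rw [pow_succ, ← pow_mul, ← pow_mul, ← pow_add]; ring_nf
    rw [e]; field_simp
  rw [sum_congr rfl hterm, ← sum_mul]
  have hgeom := sum_range_pow_le hL n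
  have hpos : 0 ≤ L ^ 3 * ((L ^ 3) ^ (n + 1))⁻¹ := by positivity
  refine (mul_le_mul_of_nonneg_right hgeom hpos).trans (le_of_eq ?_)
  have hL1 : L - 1 ≠ 0 := by linarith
  have e2 : (L ^ 3) ^ (n + 1) = L ^ n * (L ^ 2) ^ n * L ^ 3 := by rw [pow_succ, ← pow_mul, ← pow_mul, ← pow_add]; ring_nf
  rw [e2]
  field_simp

/-- **THE GAP PART OF THE Λ-ROW CARRIES THE LEVEL COUNT**: `Σ_{i<n} (L²)^{−i}·(L²)^{i+1} = n·L²` (`L ≠ 0`). [folklore] -/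
theorem inner_gap_sum_eq {L : ℝ} (hL : L ≠ 0) (n : ℕ) : ∑ i ∈ range n, ((L ^ 2) ^ i)⁻¹ * (L ^ 2) ^ (i + 1) = n * L ^ 2 := by
  have hterm : ∀ i ∈ range n, ((L ^ 2) ^ i)⁻¹ * (L ^ 2) ^ (i + 1) = L ^ 2 := by
    intro i _
    have h0 : (L ^ 2) ^ i ≠ 0 := by positivity
    have e : (L ^ 2) ^ (i + 1) = (L ^ 2) ^ i * L ^ 2 := pow_succ _ _
    rw [e, ← mul_assoc, inv_mul_cancel₀ h0, one_mul]
  rw [sum_congr rfl hterm, sum_const, card_range, nsmul_eq_mul]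

/-- **THE Λ-ROW OF ONE SOURCE LEVEL, SUMMED OVER THE SAMPLING LEVELS**: with `E, cΛ, V, V′, MASS, GAP ≥ 0` and `1 < L`,
`Σ_{i<n} E·(L²)^{−i}·cΛ·(V·(L³)^{i+1}·((L³)^{n+1})⁻¹·MASS + V′·(L²)^{i+1}·GAP) ≤ E·cΛ·V∕(L−1)·((L²)^n)⁻¹·MASS + E·cΛ·V′·L²·n·GAP`. [cite: Balaban1985Averaging, (124)-(126) p.36] -/
theorem lambda_row_le {L : ℝ} (hL : 1 < L) {E cΛ V V' MASS GAP : ℝ} (hE : 0 ≤ E) (hc : 0 ≤ cΛ) (hV : 0 ≤ V) (hM : 0 ≤ MASS) (n : ℕ) :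
    ∑ i ∈ range n, E * ((L ^ 2) ^ i)⁻¹ * cΛ * (V * (L ^ 3) ^ (i + 1) * ((L ^ 3) ^ (n + 1))⁻¹ * MASS + V' * (L ^ 2) ^ (i + 1) * GAP)
      ≤ E * cΛ * V / (L - 1) * ((L ^ 2) ^ n)⁻¹ * MASS + E * cΛ * V' * L ^ 2 * n * GAP := by
  have hL0 : 0 < L := by linarith
  have h1 := inner_mass_sum_le hL n
  have h2 := inner_gap_sum_eq hL0.ne' n
  have e : ∑ i ∈ range n, E * ((L ^ 2) ^ i)⁻¹ * cΛ * (V * (L ^ 3) ^ (i + 1) * ((L ^ 3) ^ (n + 1))⁻¹ * MASS + V' * (L ^ 2) ^ (i + 1) * GAP)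
      = E * cΛ * V * MASS * ∑ i ∈ range n, ((L ^ 2) ^ i)⁻¹ * ((L ^ 3) ^ (i + 1) * ((L ^ 3) ^ (n + 1))⁻¹)
        + E * cΛ * V' * GAP * ∑ i ∈ range n, ((L ^ 2) ^ i)⁻¹ * (L ^ 2) ^ (i + 1) := by
    rw [mul_sum, mul_sum, ← sum_add_distrib]
    exact sum_congr rfl fun i _ => by ring
  rw [e, h2]
  have hA : 0 ≤ E * cΛ * V * MASS := by positivity
  have h3 : E * cΛ * V * MASS * ∑ i ∈ range n, ((L ^ 2) ^ i)⁻¹ * ((L ^ 3) ^ (i + 1) * ((L ^ 3) ^ (n + 1))⁻¹)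
      ≤ E * cΛ * V / (L - 1) * ((L ^ 2) ^ n)⁻¹ * MASS := by
    calc _ ≤ E * cΛ * V * MASS * (((L ^ 2) ^ n)⁻¹ / (L - 1)) := mul_le_mul_of_nonneg_left h1 hA
      _ = _ := by ring
  have h4 : E * cΛ * V' * GAP * ((n : ℝ) * L ^ 2) = E * cΛ * V' * L ^ 2 * n * GAP := by ring
  linarith [h3, h4.le, h4.ge]

/-! ## §2 ★★ The assembly: both slots, no factor `l` -/

/-- ★★ **THE PURE-REAL ASSEMBLY OF THE H2-1(E) KNIT.**  Reals `2 ≤ L`, `E, cS, cΛ, V, V′, Am, Bm, Bg, M, G₀ ≥ 0`; per-level rows for `j < l` (with `n := l − 1 − j`):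
STRAIGHT `S j ≤ E·((L²)^{l−1−j})⁻¹·cS·MASS j`; LAMBDA `Λ j ≤ Σ_{i<l−1−j} E·(L²)^{−i}·cΛ·(V·(L³)^{i+1}·((L³)^{l−j})⁻¹·MASS j + V′·(L²)^{i+1}·GAP j)`; the comb masses
`MASS j ≤ Am·(Lʲ)⁻¹ + Bm·Lʲ` (`hMcomb`, every level) and norm gaps `GAP j ≤ Bg·Lʲ` ((G_j)), all nonnegative; the level-0 source term
`Z₀ ≤ E·((L²)^l)⁻¹·cS·M + Σ_{i<l} E·(L²)^{−i}·cΛ·(V·(L³)^{i+1}·((L³)^{l+1})⁻¹·M + V′·(L²)^{i+1}·G₀)`.  THEN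
`Z₀ + Σ_{j<l}(S j + Λ j) ≤ Am₂·(Lˡ)⁻¹ + Bm₂·Lˡ`, `Am₂ = E·(cS + cΛ·V∕(L−1))·(Am·L²∕(L−1) + M)`, `Bm₂ = E·(cS + cΛ·V∕(L−1))·Bm·L²∕(L³−1) + E·cΛ·V′·L²·(Bg∕(L−1)² + G₀)` —
BOTH SLOTS GEOMETRIC FROM THE TOP, NO FACTOR `l` (the level count of the gap branch is absorbed by ✓ `sum_range_sub_mul_pow_le`, `l·(L²)^{−l}… ` never appears).
[cite: Balaban1985Averaging, (43) p.24, (124)-(126) p.36; Balaban1984PropagatorsI, (1.18)-(1.20) pp.19-20; Balaban1985Variational, Prop. 7 p.299] -/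
theorem h21E_real_assembly (L : ℝ) (hL : 2 ≤ L) (l : ℕ)
    {E cS cΛ V V' Am Bm Bg M G₀ : ℝ} (hE : 0 ≤ E) (hcS : 0 ≤ cS) (hcΛ : 0 ≤ cΛ) (hV : 0 ≤ V) (hV' : 0 ≤ V') (hAm : 0 ≤ Am) (hBm : 0 ≤ Bm) (hBg : 0 ≤ Bg)
    (hM0 : 0 ≤ M) (hG₀ : 0 ≤ G₀)
    (S Λ MASS GAP : ℕ → ℝ) (hMASS0 : ∀ j < l, 0 ≤ MASS j)
    (hMASS : ∀ j < l, MASS j ≤ Am * (L ^ j)⁻¹ + Bm * L ^ j) (hGAP : ∀ j < l, GAP j ≤ Bg * L ^ j)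
    (hS : ∀ j < l, S j ≤ E * ((L ^ 2) ^ (l - 1 - j))⁻¹ * cS * MASS j)
    (hΛ : ∀ j < l, Λ j ≤ ∑ i ∈ range (l - 1 - j), E * ((L ^ 2) ^ i)⁻¹ * cΛ * (V * (L ^ 3) ^ (i + 1) * ((L ^ 3) ^ (l - 1 - j + 1))⁻¹ * MASS j + V' * (L ^ 2) ^ (i + 1) * GAP j))
    {Z₀ : ℝ} (hZ₀ : Z₀ ≤ E * ((L ^ 2) ^ l)⁻¹ * cS * M + ∑ i ∈ range l, E * ((L ^ 2) ^ i)⁻¹ * cΛ * (V * (L ^ 3) ^ (i + 1) * ((L ^ 3) ^ (l + 1))⁻¹ * M + V' * (L ^ 2) ^ (i + 1) * G₀)) :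
    Z₀ + ∑ j ∈ range l, (S j + Λ j)
      ≤ E * (cS + cΛ * V / (L - 1)) * (Am * (L ^ 2 / (L - 1)) + M) * (L ^ l)⁻¹
        + (E * (cS + cΛ * V / (L - 1)) * Bm * (L ^ 2 / (L ^ 3 - 1)) + E * cΛ * V' * L ^ 2 * (Bg / (L - 1) ^ 2 + G₀)) * L ^ l := by
  have hL1 : 1 < L := by linarith
  have hL0 : 0 < L := by linarith
  have hLm1 : 0 < L - 1 := by linarith
  have hK0 : 0 ≤ cS + cΛ * V / (L - 1) := by positivity
  -- per level: `S j + Λ j ≤ E(cS + cΛV/(L−1))·(L²)^{−(l−1−j)}·MASS j + EcΛV′L²·(l−1−j)·GAP j`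
  have hlev : ∀ j ∈ range l, S j + Λ j
      ≤ E * (cS + cΛ * V / (L - 1)) * (((L ^ 2)⁻¹) ^ (l - 1 - j) * MASS j) + E * cΛ * V' * L ^ 2 * (((l : ℝ) - 1 - j) * GAP j) := by
    intro j hj
    have hjl := mem_range.mp hj
    have h1 := hS j hjl
    have h2 := (hΛ j hjl).trans (lambda_row_le hL1 hE hcΛ hV (hMASS0 j hjl) (l - 1 - j))
    have hn : ((l - 1 - j : ℕ) : ℝ) = (l : ℝ) - 1 - j := by
      rw [Nat.cast_sub (by omega), Nat.cast_sub (by omega)]; push_cast; ring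
    rw [hn] at h2
    have hinv : ((L ^ 2) ^ (l - 1 - j))⁻¹ = ((L ^ 2)⁻¹) ^ (l - 1 - j) := by rw [inv_pow]
    rw [hinv] at h1 h2
    have e : E * (cS + cΛ * V / (L - 1)) * (((L ^ 2)⁻¹) ^ (l - 1 - j) * MASS j) + E * cΛ * V' * L ^ 2 * (((l : ℝ) - 1 - j) * GAP j)
        = E * ((L ^ 2)⁻¹) ^ (l - 1 - j) * cS * MASS j + (E * cΛ * V / (L - 1) * ((L ^ 2)⁻¹) ^ (l - 1 - j) * MASS j + E * cΛ * V' * L ^ 2 * ((l : ℝ) - 1 - j) * GAP j) := by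
      ring
    rw [e]; exact add_le_add h1 h2
  -- the mass channel (✓ `levelSum_damped_le`) and the gap channel (✓ `sum_range_sub_mul_pow_le`)
  have hmass := levelSum_damped_le L hL l Am Bm hAm hBm MASS hMASS
  have hgap : ∑ j ∈ range l, ((l : ℝ) - 1 - j) * GAP j ≤ Bg * (L ^ l / (L - 1) ^ 2) := by
    have h1 : ∑ j ∈ range l, ((l : ℝ) - 1 - j) * GAP j ≤ ∑ j ∈ range l, Bg * (((l : ℝ) - 1 - j) * L ^ j) := by
      refine sum_le_sum fun j hj => ?_
      have hjl := mem_range.mp hj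
      have hpos : 0 ≤ (l : ℝ) - 1 - j := by
        have : (j : ℝ) + 1 ≤ l := by exact_mod_cast hjl
        linarith
      have := mul_le_mul_of_nonneg_left (hGAP j hjl) hpos
      linarith [this]
    rw [← mul_sum] at h1
    exact h1.trans (mul_le_mul_of_nonneg_left (sum_range_sub_mul_pow_le hL1 l) hBg)
  -- the level-0 term
  have hZ : Z₀ ≤ E * (cS + cΛ * V / (L - 1)) * M * (L ^ l)⁻¹ + E * cΛ * V' * L ^ 2 * G₀ * L ^ l := by
    have h2 := lambda_row_le (V' := V') (GAP := G₀) hL1 hE hcΛ hV hM0 l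
    have hZ' := hZ₀.trans (add_le_add le_rfl h2)
    -- `((L²)^l)⁻¹ ≤ (L^l)⁻¹` and `l ≤ L^l`
    have hLl : 0 < L ^ l := by positivity
    have hsq : ((L ^ 2) ^ l)⁻¹ ≤ (L ^ l)⁻¹ := by
      rw [← pow_mul, show 2 * l = l + l by ring, pow_add, mul_inv]
      have h1 : (L ^ l)⁻¹ ≤ 1 := inv_le_one_of_one_le₀ (one_le_pow₀ hL1.le)
      have h0 : 0 ≤ (L ^ l)⁻¹ := by positivity
      calc (L ^ l)⁻¹ * (L ^ l)⁻¹ ≤ (L ^ l)⁻¹ * 1 := mul_le_mul_of_nonneg_left h1 h0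
        _ = (L ^ l)⁻¹ := mul_one _
    have hlL : (l : ℝ) ≤ L ^ l := by
      have h := one_add_mul_le_pow (show (-2 : ℝ) ≤ L - 1 by linarith) l
      have hl0 : (0 : ℝ) ≤ l := Nat.cast_nonneg l
      have h5 : (l : ℝ) * 1 ≤ l * (L - 1) := mul_le_mul_of_nonneg_left (by linarith) hl0
      have e : 1 + (L - 1) = L := by ring
      rw [e] at h; linarith
    have hc1 : 0 ≤ E * (cS + cΛ * V / (L - 1)) * M := by positivity
    have hc2 : 0 ≤ E * cΛ * V' * L ^ 2 * G₀ := by positivity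
    have e1 : E * ((L ^ 2) ^ l)⁻¹ * cS * M + (E * cΛ * V / (L - 1) * ((L ^ 2) ^ l)⁻¹ * M + E * cΛ * V' * L ^ 2 * l * G₀)
        = E * (cS + cΛ * V / (L - 1)) * M * ((L ^ 2) ^ l)⁻¹ + E * cΛ * V' * L ^ 2 * G₀ * l := by ring
    rw [e1] at hZ'
    have p1 := mul_le_mul_of_nonneg_left hsq hc1
    have p2 := mul_le_mul_of_nonneg_left hlL hc2
    linarith [hZ', p1, p2]
  -- assemble
  have hsum : ∑ j ∈ range l, (S j + Λ j)
      ≤ E * (cS + cΛ * V / (L - 1)) * ∑ j ∈ range l, ((L ^ 2)⁻¹) ^ (l - 1 - j) * MASS j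
        + E * cΛ * V' * L ^ 2 * ∑ j ∈ range l, ((l : ℝ) - 1 - j) * GAP j := by
    calc ∑ j ∈ range l, (S j + Λ j)
        ≤ ∑ j ∈ range l, (E * (cS + cΛ * V / (L - 1)) * (((L ^ 2)⁻¹) ^ (l - 1 - j) * MASS j) + E * cΛ * V' * L ^ 2 * (((l : ℝ) - 1 - j) * GAP j)) :=
          sum_le_sum hlev
      _ = _ := by rw [sum_add_distrib, mul_sum, mul_sum]
  have hc3 : 0 ≤ E * (cS + cΛ * V / (L - 1)) := by positivity
  have hc4 : 0 ≤ E * cΛ * V' * L ^ 2 := by positivity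
  have h3 := mul_le_mul_of_nonneg_left hmass hc3
  have h4 := mul_le_mul_of_nonneg_left hgap hc4
  have e : E * (cS + cΛ * V / (L - 1)) * (Am * (L ^ 2 / (L - 1)) + M) * (L ^ l)⁻¹
        + (E * (cS + cΛ * V / (L - 1)) * Bm * (L ^ 2 / (L ^ 3 - 1)) + E * cΛ * V' * L ^ 2 * (Bg / (L - 1) ^ 2 + G₀)) * L ^ l
      = (E * (cS + cΛ * V / (L - 1)) * M * (L ^ l)⁻¹ + E * cΛ * V' * L ^ 2 * G₀ * L ^ l)
        + (E * (cS + cΛ * V / (L - 1)) * (Am * (L ^ 2 / (L - 1)) * (L ^ l)⁻¹ + Bm * (L ^ 2 / (L ^ 3 - 1)) * L ^ l)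
          + E * cΛ * V' * L ^ 2 * (Bg * (L ^ l / (L - 1) ^ 2))) := by
    ring
  rw [e]
  linarith [hsum, h3, h4, hZ]

end Summit.QuantumFields.YangMills.Theorems.Prop7CornerCombH21ERealAssembly

end
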